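import Summits.ResolutionOfSingularities.ResolutionOfSingularities.Theorems.UniversalCellsCampaignW82DiagonalCriterionScheme
import Summits.ResolutionOfSingularities.ResolutionOfSingularities.Theorems.UniversalCellsCampaignW82FrobeniusTwistProofs
import Summits.ResolutionOfSingularities.ResolutionOfSingularities.Theorems.UniversalCellsPrimeFieldToPerfectOfSmoothTwist
import HarnessLib

/-!
# [OURS · L1 W8.2] The residual of slot W8.2 and the kernel `SmoothTwist` in SELF-PRODUCT form: «a model `Y` with
# `Y ×_K Y` REGULAR» in place of «a SMOOTH model `Y`», by name, over every field

Cell `res-hironaka` (run/shared/lean/pub/res-hironaka/), LADDER-RESOLUTION rung L (RESCUE), slot W8.2; host route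
`UniversalCells`, host item `PrimeFieldToPerfect` (stmt-ResolutionOfSingularities-15233), door 1. Links leaf
(imports the Theses cone through `…PrimeFieldToPerfectOfSmoothTwist`), written by res-L1-s82-pv-1 (gen 6), over
the scheme form of the diagonal criterion (`…DiagonalCriterionScheme`: `Smooth q ↔ Scheme.IsRegular (pullback q q)`
for `q : Y ⟶ Spec K` locally of finite type, ANY field `K`):

* `hasSmoothFrobeniusTwistModel_iff_regularSelfProduct` — for every field `K` of exponential characteristic `p`
  and every `f₀ : X₀ ⟶ Spec K` locally of finite type: `HasSmoothFrobeniusTwistModel p K f₀` (gen 2, some Frobenius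
  twist `X₀^{(p^e)}` has a SMOOTH proper birational model) ⟺ some twist has a proper birational model `Y` whose
  SELF-PRODUCT `Y ×_K Y` is a regular scheme.
* `hasSmoothModelAtFiniteLevel_iff_regularSelfProduct` — the same for `HasSmoothModelAtFiniteLevel K f₀` (a smooth
  model after a FINITE purely inseparable extension `K'/K`; binder for binder the conclusion of the registered stub
  `stub_smoothTwist` of stmt-15233): ⟺ a model `Y → X₀ ×_K K'` with `Y ×_{K'} Y` regular.
* `frobeniusTwistStepAt_iff_regularSelfProductStep` — the residual `FrobeniusTwistStepAt p M n` (≡ `PerfectionStepAt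
  M n`, `perfectionStepAt_iff_frobeniusTwistStepAt`) of slot W8.2 in self-product form, for EVERY field `M` of
  characteristic `p` (forms (E3)/(E4) needed `M` perfect; (E5) does not); `perfectionStepAt_iff_regularSelfProductStep`.
* **`primeFieldToPerfect_of_regularSelfProductTwist`** — the crux `UniversalCells.PrimeFieldToPerfect` from the
  kernel `SmoothTwist` of Cruxes/PrimeFieldToPerfect/KERNEL.md §1 with «`Y` SMOOTH over `K'`» replaced by
  «`Y ×_{K'} Y` REGULAR» — a hypothesis about regular schemes only, over finitely generated fields `K` of ANY
  `p`-rank (`Theorems.PrimeFieldToPerfect.primeFieldToPerfect_of_smoothTwist`, gens 0–1, composed with (E5)).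

HONEST FRAMING. OURS theorems; NOT statements of [Hironaka2017]; nothing attributed to its author. These are
NORMAL FORMS (equivalences), not progress on the open residual (`PerfectionStepAt M n`, `n ≥ 4`). AI work, weaker
than expert review; no claim beyond the kernel. No `sorry`, no new axioms.
-/

noncomputable section

set_option linter.dupNamespace false -- mandated namespace of this single-conjunct summit

open CategoryTheory CategoryTheory.Limits AlgebraicGeometry TopologicalSpace
open Literature.AlgebraicGeometry.Resolution

namespace Summit.ResolutionOfSingularities.ResolutionOfSingularities.Theorems.CampaignW82

universe u

/-! ## The two model predicates in self-product form -/

/-- **A smooth model of a Frobenius twist = a model of a twist with regular self-product** (any field `K` of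
exponential characteristic `p`, `f₀` locally of finite type): `HasSmoothFrobeniusTwistModel p K f₀` iff for some
`e` the twist `X₀^{(p^e)}` has a proper birational model `Y` with `Y ×_K Y` a regular scheme. [folklore] -/
theorem hasSmoothFrobeniusTwistModel_iff_regularSelfProduct (p : ℕ) (K : Type u) [Field K] [ExpChar K p]
    {X₀ : Scheme.{u}} (f₀ : X₀ ⟶ Spec (.of K)) [LocallyOfFiniteType f₀] :
    HasSmoothFrobeniusTwistModel p K f₀ ↔
      ∃ (e : ℕ) (Y : Scheme.{u})
        (π : Y ⟶ pullback f₀ (Spec.map (CommRingCat.ofHom (iterateFrobenius K p e)))),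
        IsProper π ∧ IsBirational π ∧
          Scheme.IsRegular
            (pullback (π ≫ pullback.snd f₀ (Spec.map (CommRingCat.ofHom (iterateFrobenius K p e))))
              (π ≫ pullback.snd f₀ (Spec.map (CommRingCat.ofHom (iterateFrobenius K p e))))) := by
  rw [hasSmoothFrobeniusTwistModel_iff]
  refine ⟨?_, ?_⟩
  · rintro ⟨e, Y, π, hπ, hbir, hsm⟩
    refine ⟨e, Y, π, hπ, hbir, ?_⟩
    haveI := hsm
    exact isRegular_pullback_self_of_smooth
      (π ≫ pullback.snd f₀ (Spec.map (CommRingCat.ofHom (iterateFrobenius K p e))))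
  · rintro ⟨e, Y, π, hπ, hbir, hreg⟩
    refine ⟨e, Y, π, hπ, hbir, ?_⟩
    haveI := hπ
    haveI : LocallyOfFiniteType
        (π ≫ pullback.snd f₀ (Spec.map (CommRingCat.ofHom (iterateFrobenius K p e)))) := inferInstance
    exact smooth_of_isRegular_pullback_self _ hreg

/-- **A smooth model at a finite level = a model with regular self-product at a finite level** (any field `K`,
`f₀` locally of finite type): `HasSmoothModelAtFiniteLevel K f₀` iff for some FINITE purely inseparable `K'/K` the
base change `X₀ ×_K K'` has a proper birational model `Y` with `Y ×_{K'} Y` a regular scheme. [folklore] -/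
theorem hasSmoothModelAtFiniteLevel_iff_regularSelfProduct (K : Type u) [Field K] {X₀ : Scheme.{u}}
    (f₀ : X₀ ⟶ Spec (.of K)) [LocallyOfFiniteType f₀] :
    HasSmoothModelAtFiniteLevel K f₀ ↔
      ∃ (K' : Type u) (_ : Field K') (_ : Algebra K K') (_ : IsPurelyInseparable K K') (_ : Module.Finite K K')
        (Y : Scheme.{u}) (π : Y ⟶ pullback f₀ (Spec.map (CommRingCat.ofHom (algebraMap K K')))),
        IsProper π ∧ IsBirational π ∧
          Scheme.IsRegular
            (pullback (π ≫ pullback.snd f₀ (Spec.map (CommRingCat.ofHom (algebraMap K K'))))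
              (π ≫ pullback.snd f₀ (Spec.map (CommRingCat.ofHom (algebraMap K K'))))) := by
  rw [hasSmoothModelAtFiniteLevel_iff]
  refine ⟨?_, ?_⟩
  · rintro ⟨K', iF, iA, iP, iM, Y, π, hπ, hbir, hsm⟩
    refine ⟨K', iF, iA, iP, iM, Y, π, hπ, hbir, ?_⟩
    haveI := hsm
    exact isRegular_pullback_self_of_smooth
      (π ≫ pullback.snd f₀ (Spec.map (CommRingCat.ofHom (algebraMap K K'))))
  · rintro ⟨K', iF, iA, iP, iM, Y, π, hπ, hbir, hreg⟩
    refine ⟨K', iF, iA, iP, iM, Y, π, hπ, hbir, ?_⟩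
    haveI := hπ
    haveI : LocallyOfFiniteType
        (π ≫ pullback.snd f₀ (Spec.map (CommRingCat.ofHom (algebraMap K K')))) := inferInstance
    exact smooth_of_isRegular_pullback_self _ hreg

/-! ## The residual of slot W8.2 in self-product form -/

/-- **The Frobenius-twist step (≡ the perfection step) in SELF-PRODUCT form**, for EVERY field `M` of
characteristic `p` and every grade `n`: `FrobeniusTwistStepAt p M n` iff, granted resolution of integral separated
finite-type schemes of dimension `≤ n` over `M(t)`, every separated finite-type `X₀/M(t)` of dimension `≤ n` integral
over the perfect closure has a level `e` and a proper birational model `Y` of `X₀^{(p^e)}` with `Y ×_{M(t)} Y`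
REGULAR. [folklore] -/
theorem frobeniusTwistStepAt_iff_regularSelfProductStep (p : ℕ) [Fact p.Prime] (M : Type) [Field M] [CharP M p]
    (n : WithBot ℕ∞) :
    FrobeniusTwistStepAt p M n ↔
      ((∀ (X : Scheme.{0}) (f : X ⟶ Spec (.of (RatFunc M))),
          IsSeparated f → LocallyOfFiniteType f → QuasiCompact f → IsIntegral X →
            topologicalKrullDim X ≤ n → Scheme.HasResolution X) →
        ∀ (X₀ : Scheme.{0}) (f₀ : X₀ ⟶ Spec (.of (RatFunc M))),
          IsSeparated f₀ → LocallyOfFiniteType f₀ → QuasiCompact f₀ → topologicalKrullDim X₀ ≤ n →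
            IntegralOverPerfectClosure (RatFunc M) f₀ →
            ∃ (e : ℕ) (Y : Scheme.{0})
              (π : Y ⟶ pullback f₀ (Spec.map (CommRingCat.ofHom (iterateFrobenius (RatFunc M) p e)))),
              IsProper π ∧ IsBirational π ∧
                Scheme.IsRegular
                  (pullback (π ≫ pullback.snd f₀ (Spec.map (CommRingCat.ofHom (iterateFrobenius (RatFunc M) p e))))
                    (π ≫ pullback.snd f₀
                      (Spec.map (CommRingCat.ofHom (iterateFrobenius (RatFunc M) p e)))))) := by
  refine ⟨fun h hres X₀ f₀ hs hl hq hd hint => ?_, fun h hres X₀ f₀ hs hl hq hd hint => ?_⟩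
  · haveI := hl
    exact (hasSmoothFrobeniusTwistModel_iff_regularSelfProduct p (RatFunc M) f₀).mp
      (h hres X₀ f₀ hs hl hq hd hint)
  · haveI := hl
    exact (hasSmoothFrobeniusTwistModel_iff_regularSelfProduct p (RatFunc M) f₀).mpr
      (h hres X₀ f₀ hs hl hq hd hint)

/-- **The perfection step in SELF-PRODUCT form** (every field `M` of characteristic `p`, every grade): through
`perfectionStepAt_iff_frobeniusTwistStepAt` (gen 2). [folklore] -/
theorem perfectionStepAt_iff_regularSelfProductStep (p : ℕ) [Fact p.Prime] (M : Type) [Field M] [CharP M p]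
    (n : WithBot ℕ∞) :
    PerfectionStepAt M n ↔
      ((∀ (X : Scheme.{0}) (f : X ⟶ Spec (.of (RatFunc M))),
          IsSeparated f → LocallyOfFiniteType f → QuasiCompact f → IsIntegral X →
            topologicalKrullDim X ≤ n → Scheme.HasResolution X) →
        ∀ (X₀ : Scheme.{0}) (f₀ : X₀ ⟶ Spec (.of (RatFunc M))),
          IsSeparated f₀ → LocallyOfFiniteType f₀ → QuasiCompact f₀ → topologicalKrullDim X₀ ≤ n →
            IntegralOverPerfectClosure (RatFunc M) f₀ →
            ∃ (e : ℕ) (Y : Scheme.{0})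
              (π : Y ⟶ pullback f₀ (Spec.map (CommRingCat.ofHom (iterateFrobenius (RatFunc M) p e)))),
              IsProper π ∧ IsBirational π ∧
                Scheme.IsRegular
                  (pullback (π ≫ pullback.snd f₀ (Spec.map (CommRingCat.ofHom (iterateFrobenius (RatFunc M) p e))))
                    (π ≫ pullback.snd f₀
                      (Spec.map (CommRingCat.ofHom (iterateFrobenius (RatFunc M) p e)))))) :=
  (perfectionStepAt_iff_frobeniusTwistStepAt p M n).trans (frobeniusTwistStepAt_iff_regularSelfProductStep p M n)

/-! ## The graded residuals of both doors in self-product form -/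

/-- **Door 1's graded residual `PerfectionStepDimLe p n` in SELF-PRODUCT form**: for every PERFECT field `M` of
characteristic `p`, the self-product step of `perfectionStepAt_iff_regularSelfProductStep`. [folklore] -/
theorem perfectionStepDimLe_iff_forall_regularSelfProductStep (p : ℕ) [Fact p.Prime] (n : WithBot ℕ∞) :
    PerfectionStepDimLe p n ↔
      ∀ (M : Type) [Field M] [CharP M p] [PerfectField M],
        ((∀ (X : Scheme.{0}) (f : X ⟶ Spec (.of (RatFunc M))),
            IsSeparated f → LocallyOfFiniteType f → QuasiCompact f → IsIntegral X →
              topologicalKrullDim X ≤ n → Scheme.HasResolution X) →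
          ∀ (X₀ : Scheme.{0}) (f₀ : X₀ ⟶ Spec (.of (RatFunc M))),
            IsSeparated f₀ → LocallyOfFiniteType f₀ → QuasiCompact f₀ → topologicalKrullDim X₀ ≤ n →
              IntegralOverPerfectClosure (RatFunc M) f₀ →
              ∃ (e : ℕ) (Y : Scheme.{0})
                (π : Y ⟶ pullback f₀ (Spec.map (CommRingCat.ofHom (iterateFrobenius (RatFunc M) p e)))),
                IsProper π ∧ IsBirational π ∧
                  Scheme.IsRegular
                    (pullback
                      (π ≫ pullback.snd f₀ (Spec.map (CommRingCat.ofHom (iterateFrobenius (RatFunc M) p e))))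
                      (π ≫ pullback.snd f₀
                        (Spec.map (CommRingCat.ofHom (iterateFrobenius (RatFunc M) p e)))))) := by
  rw [perfectionStepDimLe_iff_forall]
  exact ⟨fun h M _ _ _ => (perfectionStepAt_iff_regularSelfProductStep p M n).mp (h M),
    fun h M _ _ _ => (perfectionStepAt_iff_regularSelfProductStep p M n).mpr (h M)⟩

/-- **Door 2's graded residual `PerfectionStepAlgClosedDimLe p n` in SELF-PRODUCT form**: for every
ALGEBRAICALLY CLOSED field `M` of characteristic `p`, the same. [folklore] -/
theorem perfectionStepAlgClosedDimLe_iff_forall_regularSelfProductStep (p : ℕ) [Fact p.Prime] (n : WithBot ℕ∞) :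
    PerfectionStepAlgClosedDimLe p n ↔
      ∀ (M : Type) [Field M] [CharP M p] [IsAlgClosed M],
        ((∀ (X : Scheme.{0}) (f : X ⟶ Spec (.of (RatFunc M))),
            IsSeparated f → LocallyOfFiniteType f → QuasiCompact f → IsIntegral X →
              topologicalKrullDim X ≤ n → Scheme.HasResolution X) →
          ∀ (X₀ : Scheme.{0}) (f₀ : X₀ ⟶ Spec (.of (RatFunc M))),
            IsSeparated f₀ → LocallyOfFiniteType f₀ → QuasiCompact f₀ → topologicalKrullDim X₀ ≤ n →
              IntegralOverPerfectClosure (RatFunc M) f₀ →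
              ∃ (e : ℕ) (Y : Scheme.{0})
                (π : Y ⟶ pullback f₀ (Spec.map (CommRingCat.ofHom (iterateFrobenius (RatFunc M) p e)))),
                IsProper π ∧ IsBirational π ∧
                  Scheme.IsRegular
                    (pullback
                      (π ≫ pullback.snd f₀ (Spec.map (CommRingCat.ofHom (iterateFrobenius (RatFunc M) p e))))
                      (π ≫ pullback.snd f₀
                        (Spec.map (CommRingCat.ofHom (iterateFrobenius (RatFunc M) p e)))))) := by
  rw [perfectionStepAlgClosedDimLe_iff_forall]
  exact ⟨fun h M _ _ _ => (perfectionStepAt_iff_regularSelfProductStep p M n).mp (h M),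
    fun h M _ _ _ => (perfectionStepAt_iff_regularSelfProductStep p M n).mpr (h M)⟩

/-! ## The crux from the kernel in self-product form -/

/-- **`PrimeFieldToPerfect` from the kernel `SmoothTwist` in SELF-PRODUCT form.** If, for every prime `p`,
resolution of integral separated finite-type schemes over `Spec (ZMod p)` and over every finitely generated field
of characteristic `p` implies that every separated finite-type `X₀` over a finitely generated `K` which is
integral over some perfect purely inseparable `L ⊇ K` acquires, over some FINITE purely inseparable `K'/K`, a
proper birational model `Y → X₀ ×_K K'` whose SELF-PRODUCT `Y ×_{K'} Y` is a REGULAR scheme — then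
`UniversalCells.PrimeFieldToPerfect` holds (`primeFieldToPerfect_of_smoothTwist` with smoothness of `Y/K'`
supplied by the diagonal criterion; no hypothesis on `K` beyond finite generation). [folklore] -/
theorem primeFieldToPerfect_of_regularSelfProductTwist
    (hST : ∀ (p : ℕ), p.Prime →
      (∀ (X : Scheme.{0}) (f : X ⟶ Spec (.of (ZMod p))), IsSeparated f → LocallyOfFiniteType f →
        QuasiCompact f → IsIntegral X → Scheme.HasResolution X) →
      (∀ (K : Type) [Field K] [CharP K p], (∃ s : Finset K, Subfield.closure (s : Set K) = ⊤) →
        ∀ (X : Scheme.{0}) (f : X ⟶ Spec (.of K)), IsSeparated f → LocallyOfFiniteType f →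
          QuasiCompact f → IsIntegral X → Scheme.HasResolution X) →
      ∀ (K : Type) [Field K] [CharP K p], (∃ s : Finset K, Subfield.closure (s : Set K) = ⊤) →
        ∀ (X₀ : Scheme.{0}) (f₀ : X₀ ⟶ Spec (.of K)),
          IsSeparated f₀ → LocallyOfFiniteType f₀ → QuasiCompact f₀ →
          (∃ (L : Type) (_ : Field L) (_ : PerfectField L) (_ : Algebra K L)
              (_ : IsPurelyInseparable K L),
              IsIntegral (pullback f₀ (Spec.map (CommRingCat.ofHom (algebraMap K L))))) →
          ∃ (K' : Type) (_ : Field K') (_ : Algebra K K') (_ : IsPurelyInseparable K K')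
            (_ : Module.Finite K K') (Y : Scheme.{0})
            (π : Y ⟶ pullback f₀ (Spec.map (CommRingCat.ofHom (algebraMap K K')))),
            IsProper π ∧ IsBirational π ∧
              Scheme.IsRegular
                (pullback (π ≫ pullback.snd f₀ (Spec.map (CommRingCat.ofHom (algebraMap K K'))))
                  (π ≫ pullback.snd f₀ (Spec.map (CommRingCat.ofHom (algebraMap K K')))))) :
    Summit.ResolutionOfSingularities.ResolutionOfSingularities.Theses.UniversalCells.PrimeFieldToPerfect := by
  refine PrimeFieldToPerfect.primeFieldToPerfect_of_smoothTwist
    fun p hp h₀ hfg K _ _ hK X₀ f₀ hs hl hq hint => ?_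
  haveI := hl
  exact (hasSmoothModelAtFiniteLevel_iff_regularSelfProduct K f₀).mpr
    (hST p hp h₀ hfg K hK X₀ f₀ hs hl hq hint)

end Summit.ResolutionOfSingularities.ResolutionOfSingularities.Theorems.CampaignW82

end
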